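import Mathlib
import Summits.Schanuel.Schanuel.Theses.RigidCore
import Summits.Schanuel.Schanuel.Theorems.AclSubsetLogFreeCore.Negative.LogFreeCoreObjects
import Summits.Schanuel.Schanuel.Theorems.AclSubsetLogFreeCore.Negative.AclSubsetLogFreeCoreIffReal
import Summits.Schanuel.Schanuel.Theorems.RigidCoreAclSubsetLogFreeCoreAclSubsetEclOfEac
import Summits.Schanuel.Schanuel.Theorems.RigidCoreAclSubsetLogFreeCoreCoreAutElementaryOfEac

/-!
# Crux `RigidCore.AclSubsetLogFreeCore` (stmt-Schanuel-0968): the conditional reduction of line `eac-extends-core-automorphisms`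

The crux (A) `acl^{ℂ_exp}(∅) ⊆ C_EA` (`Negative.aclSubsetLogFreeCore_iff : (A) ↔ expAcl ⊆ logFreeCore`)
follows from two open inputs and nothing else:

* EAC — Zilber's exponential-algebraic closedness of `ℂ_exp` (`IsExpAlgClosed ℂ`, hypothesis `hEAC`), and
* (A₀) — the fixed field of the exponential-field automorphisms of the countable core `C₀ = ecl ∅`
  (tree presentation: maps `g : ℂ → ℂ` with `IsEIsoOn g (ecl ∅) (ecl ∅)`) is log-free
  (hypothesis `hFix`).

This file records that reduction as a sorry-free theorem of the tree
(`aclSubsetLogFreeCore_of_eac_of_coreFixedField`), assembled from the two landed stubs of the line: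

* `stub_aclSubsetEcl_of_eac` (EAC ⇒ `acl(∅) ⊆ ecl(∅)`, Bays–Kirby 2018 Thm 11.6 at `b = ∅`), and
* `stub_coreAut_elementary_of_eac` (EAC ⇒ automorphisms of `C₀` preserve the traces of `∅`-definable
  sets; twisted Karp over `baseEquiv`),

through the symmetric-function bridge `Negative.expAcl_subset_of_expDcl_subset` ((A) ⟸ `dcl(∅) ⊆ C_EA`):
a pointwise `∅`-definable `d` lies in `acl(∅) ⊆ C₀` and every `g ∈ Aut_E(C₀)` maps `d` into the
`∅`-definable `{d}`, so `d` is `Aut_E(C₀)`-fixed (`expDcl_fixed_of_eac`), hence log-free by (A₀).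

So, granting EAC, the whole arithmetic content of (A) is the formula-free statement (A₀) about ONE
countable exponential field. No named unproved fact is used; both hypotheses are explicit.
-/

noncomputable section

open FirstOrder FirstOrder.Language Set
open Literature.ModelTheory.ExponentialFields
open Literature.NumberTheory.Transcendental
open Summit.Schanuel.Schanuel.Theorems.AclSubsetLogFreeCore.Negative

namespace Summit.Schanuel.Schanuel.Theorems.RigidCore

/-- Under EAC, pointwise `∅`-definable numbers are exponentially algebraic: `dcl(∅) ⊆ acl(∅) ⊆ ecl(∅)`. -/
theorem expDcl_subset_ecl_of_eac (hEAC : IsExpAlgClosed ℂ) : expDcl ⊆ ecl (∅ : Set ℂ) :=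
  fun _ hd => stub_aclSubsetEcl_of_eac hEAC (expDcl_subset_expAcl hd)

/-- Under EAC, every exponential-field automorphism of the countable core `C₀ = ecl ∅` FIXES every
pointwise `∅`-definable number (it maps `d` into the `∅`-definable set `{d}`). -/
theorem expDcl_fixed_of_eac (hEAC : IsExpAlgClosed ℂ) {d : ℂ} (hd : d ∈ expDcl)
    {g : ℂ → ℂ} (hg : IsEIsoOn g (ecl (∅ : Set ℂ)) (ecl (∅ : Set ℂ))) : g d = d := by
  have hd₁ : Set.Definable₁ (∅ : Set ℂ) Language.expRing ({d} : Set ℂ) := hd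
  have hmem : g d ∈ ({d} : Set ℂ) :=
    (stub_coreAut_elementary_of_eac hEAC g hg {d} hd₁ d (expDcl_subset_ecl_of_eac hEAC hd)).1
      (Set.mem_singleton d)
  exact Set.mem_singleton_iff.1 hmem

/-- **(A) ⟸ EAC ∧ (A₀), unbundled.** If `ℂ_exp` is exponentially-algebraically closed and the fixed
field of `Aut_E(ecl ∅)` lies in the log-free core, then `acl^{ℂ_exp}(∅) ⊆ C_EA`. -/
theorem expAcl_subset_logFreeCore_of_eac_of_coreFixedField (hEAC : IsExpAlgClosed ℂ)
    (hFix : ∀ a ∈ ecl (∅ : Set ℂ),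
      (∀ g : ℂ → ℂ, IsEIsoOn g (ecl (∅ : Set ℂ)) (ecl (∅ : Set ℂ)) → g a = a) →
        a ∈ (logFreeCore : Set ℂ)) :
    expAcl ⊆ (logFreeCore : Set ℂ) :=
  expAcl_subset_of_expDcl_subset fun d hd =>
    hFix d (expDcl_subset_ecl_of_eac hEAC hd) fun _ hg => expDcl_fixed_of_eac hEAC hd hg

/-- **(A) ⟸ EAC ∧ (A₀)** — the crux `RigidCore.AclSubsetLogFreeCore` by name, conditionally on
Zilber's EAC for `ℂ_exp` and on the residue (A₀) "the fixed field of `Aut_E(ecl ∅)` is log-free".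
Both hypotheses are OPEN; this is the kernel-checked transfer theorem of the line, not a proof of
the crux. -/
theorem aclSubsetLogFreeCore_of_eac_of_coreFixedField :
    IsExpAlgClosed ℂ →
      (∀ a ∈ ecl (∅ : Set ℂ),
        (∀ g : ℂ → ℂ, IsEIsoOn g (ecl (∅ : Set ℂ)) (ecl (∅ : Set ℂ)) → g a = a) →
          a ∈ (logFreeCore : Set ℂ)) →
        Summit.Schanuel.Schanuel.Theses.RigidCore.AclSubsetLogFreeCore :=
  fun hEAC hFix =>
    aclSubsetLogFreeCore_iff.2 (expAcl_subset_logFreeCore_of_eac_of_coreFixedField hEAC hFix)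

end Summit.Schanuel.Schanuel.Theorems.RigidCore
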